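import Mathlib
import HarnessLib
import Summits.HubbardSuperconductivity.HubbardSuperconductivity.Theorems.KLProgrammeKLRegimeTwoVolumeSrcLawStep
import Summits.HubbardSuperconductivity.HubbardSuperconductivity.Theorems.KLProgrammeKLRegimeEngineTowerBlockIncrWtKit
import Summits.HubbardSuperconductivity.HubbardSuperconductivity.Theorems.KLProgrammeKLRegimeEngineTowerBlockIncrWtKitUnits

/-!
# Route `KLProgramme` — crux K3, VL child `KLRegimeVolumeLimitV17F3` (stmt-HubbardSuperconductivity-23356), producer route «(VL)-SRC-SOFT» §S3b:
# THE SOURCE-SPECIES BLOCK STEP IN THE KIT'S DIMENSIONLESS FORM AND ITS LAW-SHAPED CLOSED FORM (pure real algebra over the door brackets)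
# (seat hubbard-kl-k3c4-p1 g19; `--supports` 23356)

`…TwoVolumeSrcBlockStepModel.klSrcPinnedSumAt_blockStep_le` (S3) bounds the species-`s` source profile of the block's output by
`t^{-s}·cr′·cc′^{2q+1}·[N(q+1) + binomial_{q+1}(N) + graded_{2q+2}(N; N₀)]` in the blind absolute input sizes `N`, for EVERY cumulant order `N₀ ≥ 2`.  This file is the
conversion every such bound undergoes, stated ABSTRACTLY (any finite label type `Γ`, any left side `b₀`, any arrays):

* §1 **`srcStep_le_kit_units`** — E1's two bricks BY NAME: the door brackets are `≤` the kit terms (`towerNumerics_doorBrackets_le_kit`, …TowerBlockIncrWtKit §1: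
  `τ = (e²(κ+ρ))²`, `Φ = eα/κ²`, `ψ = ρ⁻²`) and the absolute sizes `N m = (εKc)·(u^m·μ m)` scale out (`kitStep_abs_eq_units_mul`, …TowerBlockIncrWtKitUnits §1):
  `b₀ ≤ t^{-s}·cr′·cc′^{2q+1}·(u^{q+1}·εKc)·[μ(q+1) + towerFO D (κ²u) μ (q+1) + Σ_{n∈Icc 2 (N₀−1)} e·Φ̂^{n−1}ψ̂^{q+1}·towerS D (τu) μ n (q+1) + tail]`, `Φ̂ = (eα/κ²)·εKc`,
  `ψ̂ = ρ⁻²/u` — the zeroth order `μ(q+1)` rides along (S3 bounds the full output, not an increment);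
* §2 **`srcStep_le_law_of_profile_eps`** — composed with T2ε (`…TwoVolumeSrcLawStep.towerStep_le_profile_eps`): if the dimensionless input array has the ε-profile
  `μ m ≤ A′·λ^{max(1,m−1)}·Q′^m` (`1 ≤ m ≤ D`) and the five `λ`-rows hold at `(σ̂, τ̂, Φ̂, ψ̂) = (κ²u, (e²(κ+ρ))²u, (eα/κ²)εKc, ρ⁻²/u)`, then
  `b₀ ≤ t^{-s}·cr′·cc′^{2q+1}·(u^{q+1}·εKc)·A′·λ^{max 1 q}·[Q′^{q+1} + (4Q′)^{q+1}·8σ̂Q′ + (q+1)·e·(2τ̂ψ̂Q′)^{q+1}·M^q + 2e·(2τ̂ψ̂Q′)^{q+1}·M^{q+1}]`, `M = max 1 (2Φ̂A′τ̂Q′)`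
  — law shape `λ^{max(1,p−1)}·(per-pair constant)^p` in the output half-degree `p = q+1`, LINEAR in the input amplitude `A′`.

Pure real algebra over landed lemmas; nothing about the model is asserted; nothing asserts any stub, VL, K3 or superconductivity.
References: BGM 2006 §2.8 (2.77), (2.81)–(2.83), §3 (3.2)–(3.8) [cite: BenfattoGiulianiMastropietro2006]; Gawȩdzki–Kupiainen 1985 §3.
-/

noncomputable section

namespace Summit.HubbardSuperconductivity.HubbardSuperconductivity.Theorems.TwoVolumeDefect

set_option linter.dupNamespace false -- summit = problem name (single-conjunct summit), D-0017

open Real Finset Literature.MathematicalPhysics.QuantumLattice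
open Summit.HubbardSuperconductivity.HubbardSuperconductivity.Theorems.EngineV8

/-! ## §1 Door brackets → kit terms → units -/

/-- **The source-species step in the kit's dimensionless form.**  `Γ` finite; `κ, ρ > 0`, `α, cr′, cc′ ≥ 0`; `0 < t`; units `u, Kc > 0`, `ε > 0`; a
dimensionless array `μ ≥ 0` with `μ 0 = 0` and absolute sizes `N m = (εKc)·(u^m·μ m)`; a degree cap `D ≥ |Γ|/2`; the kit guard
`Φ̂·towerV D (τu) μ < 1`.  If for every `N₀ ≥ 2` the left side `b₀` is bounded by the door brackets of `N` (S3's shape), then for every `N₀ ≥ 2`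
`b₀ ≤ t^{-s}·cr′·cc′^{2q+1}·(u^{q+1}·εKc)·[μ(q+1) + kitRHS(μ; κ²u, τu, Φ̂, ψ̂; N₀−1)]`. [cite: BenfattoGiulianiMastropietro2006, §2.8 (2.81)-(2.83)] -/
theorem srcStep_le_kit_units {Γ : Type*} [Fintype Γ] {κ ρ α cr' cc' t ε u Kc b₀ : ℝ} (hκ : 0 < κ) (hρ : 0 < ρ) (hα : 0 ≤ α)
    (hcr : 0 ≤ cr') (hcc : 0 ≤ cc') (ht : 0 < t) (hε : 0 < ε) (hu : 0 < u) (hKc : 0 < Kc)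
    {μ : ℕ → ℝ} (hμ0 : ∀ m, 0 ≤ μ m) (hμ00 : μ 0 = 0) {D : ℕ} (hD : Fintype.card Γ / 2 ≤ D) (s q : ℕ)
    (hb : ∀ N₀ : ℕ, 2 ≤ N₀ →
      b₀ ≤ t⁻¹ ^ s * (cr' * cc' ^ (2 * q + 1) *
        ((ε * Kc) * (u ^ (q + 1) * μ (q + 1)) +
         (∑ m' ∈ range (Fintype.card Γ / 2 + 1),
            if q + 1 < m' then ((2 * m').choose (2 * (q + 1)) : ℝ) * κ ^ (2 * m' - 2 * (q + 1)) * ((ε * Kc) * (u ^ m' * μ m')) else 0) +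
         (∑ n ∈ Ico 2 N₀, (ρ⁻¹ ^ (2 * (q + 1)) * κ⁻¹ ^ (2 * (n - 1)) * (α ^ (n - 1) * Real.exp n)) *
              ∑ δ ∈ (Fintype.piFinset fun _ : Fin n => range (Fintype.card Γ / 2 + 1)) with 2 * (q + 1) + 2 * (n - 1) ≤ ∑ a, 2 * δ a,
                ∏ a, (Real.exp 2 * (κ + ρ)) ^ (2 * δ a) * ((ε * Kc) * (u ^ (δ a) * μ (δ a))) +
            ρ⁻¹ ^ (2 * (q + 1)) * (Real.exp 1 * normV Γ κ ρ (fun m' => (ε * Kc) * (u ^ m' * μ m'))) *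
              (Real.exp 1 * α * normV Γ κ ρ (fun m' => (ε * Kc) * (u ^ m' * μ m')) / κ ^ 2) ^ (N₀ - 1) /
              (1 - Real.exp 1 * α * normV Γ κ ρ (fun m' => (ε * Kc) * (u ^ m' * μ m')) / κ ^ 2)))))
    (hguard : Real.exp 1 * α / κ ^ 2 * (ε * Kc) * towerV D ((Real.exp 2 * (κ + ρ)) ^ 2 * u) μ < 1)
    {N₀ : ℕ} (hN₀ : 2 ≤ N₀) :
    b₀ ≤ t⁻¹ ^ s * (cr' * cc' ^ (2 * q + 1) * (u ^ (q + 1) * (ε * Kc)) *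
      (μ (q + 1) + (towerFO D (κ ^ 2 * u) μ (q + 1) +
        ∑ n ∈ Icc 2 (N₀ - 1), Real.exp 1 * (Real.exp 1 * α / κ ^ 2 * (ε * Kc)) ^ (n - 1) * (ρ⁻¹ ^ 2 / u) ^ (q + 1) *
          towerS D ((Real.exp 2 * (κ + ρ)) ^ 2 * u) μ n (q + 1) +
        (ρ⁻¹ ^ 2 / u) ^ (q + 1) * Real.exp 1 * towerV D ((Real.exp 2 * (κ + ρ)) ^ 2 * u) μ *
          (Real.exp 1 * α / κ ^ 2 * (ε * Kc) * towerV D ((Real.exp 2 * (κ + ρ)) ^ 2 * u) μ) ^ (N₀ - 1) /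
          (1 - Real.exp 1 * α / κ ^ 2 * (ε * Kc) * towerV D ((Real.exp 2 * (κ + ρ)) ^ 2 * u) μ)))) := by
  set N : ℕ → ℝ := fun m => (ε * Kc) * (u ^ m * μ m) with hNdef
  have hK0 : 0 < ε * Kc := mul_pos hε hKc
  have hN0 : ∀ m, 0 ≤ N m := fun m => by simp only [hNdef]; exact mul_nonneg hK0.le (mul_nonneg (pow_nonneg hu.le _) (hμ0 m))
  have hN00 : N 0 = 0 := by simp only [hNdef, hμ00, pow_zero, mul_zero]
  -- the kit guard in absolute sizes
  have hVN : towerV D ((Real.exp 2 * (κ + ρ)) ^ 2) N = (ε * Kc) * towerV D ((Real.exp 2 * (κ + ρ)) ^ 2 * u) μ := towerV_units D _ _ _ μ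
  have hguardN : Real.exp 1 * α / κ ^ 2 * towerV D ((Real.exp 2 * (κ + ρ)) ^ 2) N < 1 := by rw [hVN, ← mul_assoc]; exact hguard
  -- the door brackets `≤` the kit terms (E1 …TowerBlockIncrWtKit §1)
  have hkit := towerNumerics_doorBrackets_le_kit (Γ := Γ) hκ hρ hα hcr hcc hN0 hN00 hD hN₀ q hguardN
  -- units (E1 …TowerBlockIncrWtKitUnits §1)
  have hunits := kitStep_abs_eq_units_mul hK0.ne' hu.ne' D (κ ^ 2) ((Real.exp 2 * (κ + ρ)) ^ 2) (Real.exp 1 * α / κ ^ 2) (ρ⁻¹ ^ 2) μ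
    (N₀ - 1) (q + 1)
  have h := hb N₀ hN₀
  have hpow : 2 * (q + 1) = 2 * q + 1 + 1 := by ring
  -- rewrite the brackets of `h` in E1's shape and chain
  have hts : 0 ≤ t⁻¹ ^ s := pow_nonneg (inv_nonneg.2 ht.le) _
  have hpre : 0 ≤ cr' * cc' ^ (2 * q + 1) := mul_nonneg hcr (pow_nonneg hcc _)
  calc b₀ ≤ _ := h
    _ = t⁻¹ ^ s * (cr' * cc' ^ (2 * q + 1) * N (q + 1) +
          (cr' * cc' ^ (2 * q + 1) *
            ((∑ n ∈ Ico 2 N₀, (ρ⁻¹ ^ (2 * q + 1 + 1) * κ⁻¹ ^ (2 * (n - 1)) * (α ^ (n - 1) * Real.exp n)) *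
                ∑ δ ∈ (Fintype.piFinset fun _ : Fin n => range (Fintype.card Γ / 2 + 1)) with 2 * q + 1 + 1 + 2 * (n - 1) ≤ ∑ a, 2 * δ a,
                  ∏ a, (Real.exp 2 * (κ + ρ)) ^ (2 * δ a) * N (δ a)) +
              ρ⁻¹ ^ (2 * q + 1 + 1) * (Real.exp 1 * normV Γ κ ρ N) * (Real.exp 1 * α * normV Γ κ ρ N / κ ^ 2) ^ (N₀ - 1) /
                (1 - Real.exp 1 * α * normV Γ κ ρ N / κ ^ 2)) +
           cr' * cc' ^ (2 * q + 1) *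
            ∑ m' ∈ range (Fintype.card Γ / 2 + 1),
              (if q + 1 < m' then ((2 * m').choose (2 * (q + 1)) : ℝ) * κ ^ (2 * m' - 2 * (q + 1)) * N m' else 0))) := by
        rw [← hpow]; ring
    _ ≤ t⁻¹ ^ s * (cr' * cc' ^ (2 * q + 1) * N (q + 1) +
          cr' * cc' ^ (2 * q + 1) *
            (towerFO D (κ ^ 2) N (q + 1) +
              ∑ n ∈ Icc 2 (N₀ - 1), Real.exp 1 * (Real.exp 1 * α / κ ^ 2) ^ (n - 1) * (ρ⁻¹ ^ 2) ^ (q + 1) *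
                towerS D ((Real.exp 2 * (κ + ρ)) ^ 2) N n (q + 1) +
              (ρ⁻¹ ^ 2) ^ (q + 1) * Real.exp 1 * towerV D ((Real.exp 2 * (κ + ρ)) ^ 2) N *
                (Real.exp 1 * α / κ ^ 2 * towerV D ((Real.exp 2 * (κ + ρ)) ^ 2) N) ^ (N₀ - 1) /
                (1 - Real.exp 1 * α / κ ^ 2 * towerV D ((Real.exp 2 * (κ + ρ)) ^ 2) N))) :=
        mul_le_mul_of_nonneg_left (add_le_add le_rfl hkit) hts
    _ = _ := by
        rw [hNdef, hunits]
        ring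

/-! ## §2 Composition with T2ε: the law-shaped closed form -/

/-- **THE SOURCE-SPECIES BLOCK STEP IN LAW-SHAPED CLOSED FORM** (S3's brackets, every cumulant order, composed with E1's door-to-kit bricks, the units
identity and T2ε).  Hypotheses: as `srcStep_le_kit_units` without the guard, plus the ε-profile `μ m ≤ A′λ^{max(1,m−1)}Q′^m` (`1 ≤ m ≤ D`) and T2ε's five
`λ`-rows at `σ̂ = κ²u`, `τ̂ = (e²(κ+ρ))²u`, `Φ̂ = (eα/κ²)·εKc`, `ψ̂ = ρ⁻²/u`.  Conclusion:
`b₀ ≤ t^{-s}·cr′·cc′^{2q+1}·(u^{q+1}·εKc)·A′·λ^{max 1 q}·[Q′^{q+1} + (4Q′)^{q+1}·8σ̂Q′ + (q+1)·e·(2τ̂ψ̂Q′)^{q+1}·M^q + 2e·(2τ̂ψ̂Q′)^{q+1}·M^{q+1}]`,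
`M = max 1 (2Φ̂A′τ̂Q′)`. [cite: BenfattoGiulianiMastropietro2006, §2.8 (2.83), §2.9 (4.3)-(4.8)] -/
theorem srcStep_le_law_of_profile_eps {Γ : Type*} [Fintype Γ] {κ ρ α cr' cc' t ε u Kc b₀ A' lam Q' : ℝ} (hκ : 0 < κ) (hρ : 0 < ρ) (hα : 0 ≤ α)
    (hcr : 0 ≤ cr') (hcc : 0 ≤ cc') (ht : 0 < t) (hε : 0 < ε) (hu : 0 < u) (hKc : 0 < Kc)
    (hA' : 0 ≤ A') (hlam : 0 ≤ lam) (hlam1 : lam ≤ 1) (hQ' : 0 ≤ Q')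
    {μ : ℕ → ℝ} (hμ0 : ∀ m, 0 ≤ μ m) (hμ00 : μ 0 = 0) {D : ℕ} (hD : Fintype.card Γ / 2 ≤ D)
    (hprof : ∀ m, 1 ≤ m → m ≤ D → μ m ≤ A' * lam ^ max 1 (m - 1) * Q' ^ m) (s q : ℕ) (hqD : q + 1 ≤ D)
    (hb : ∀ N₀ : ℕ, 2 ≤ N₀ →
      b₀ ≤ t⁻¹ ^ s * (cr' * cc' ^ (2 * q + 1) *
        ((ε * Kc) * (u ^ (q + 1) * μ (q + 1)) +
         (∑ m' ∈ range (Fintype.card Γ / 2 + 1),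
            if q + 1 < m' then ((2 * m').choose (2 * (q + 1)) : ℝ) * κ ^ (2 * m' - 2 * (q + 1)) * ((ε * Kc) * (u ^ m' * μ m')) else 0) +
         (∑ n ∈ Ico 2 N₀, (ρ⁻¹ ^ (2 * (q + 1)) * κ⁻¹ ^ (2 * (n - 1)) * (α ^ (n - 1) * Real.exp n)) *
              ∑ δ ∈ (Fintype.piFinset fun _ : Fin n => range (Fintype.card Γ / 2 + 1)) with 2 * (q + 1) + 2 * (n - 1) ≤ ∑ a, 2 * δ a,
                ∏ a, (Real.exp 2 * (κ + ρ)) ^ (2 * δ a) * ((ε * Kc) * (u ^ (δ a) * μ (δ a))) +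
            ρ⁻¹ ^ (2 * (q + 1)) * (Real.exp 1 * normV Γ κ ρ (fun m' => (ε * Kc) * (u ^ m' * μ m'))) *
              (Real.exp 1 * α * normV Γ κ ρ (fun m' => (ε * Kc) * (u ^ m' * μ m')) / κ ^ 2) ^ (N₀ - 1) /
              (1 - Real.exp 1 * α * normV Γ κ ρ (fun m' => (ε * Kc) * (u ^ m' * μ m')) / κ ^ 2)))))
    -- T2ε's `λ`-rows at the kit's dimensionless constants
    (hx₁ : 4 * (κ ^ 2 * u) * lam * Q' ≤ 1 / 2)
    (hx₃ : Real.exp 1 * ((Real.exp 2 * (κ + ρ)) ^ 2 * u) * lam * Q' ≤ 1 / 2)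
    (hxs : 2 * ((Real.exp 2 * (κ + ρ)) ^ 2 * u) * Real.sqrt lam * Q' ≤ 1)
    (hz : 2 * (Real.exp 1 * α / κ ^ 2 * (ε * Kc)) * A' * ((Real.exp 2 * (κ + ρ)) ^ 2 * u) * Q' * Real.sqrt lam ≤ 1 / 2)
    (hV : (Real.exp 1 * α / κ ^ 2 * (ε * Kc)) *
      (A' * lam * (Real.exp 1 * ((Real.exp 2 * (κ + ρ)) ^ 2 * u) * Q') * (1 + 2 * (Real.exp 1 * ((Real.exp 2 * (κ + ρ)) ^ 2 * u) * Q'))) ≤ 1 / 2) :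
    b₀ ≤ t⁻¹ ^ s * (cr' * cc' ^ (2 * q + 1) * (u ^ (q + 1) * (ε * Kc))) *
      (A' * lam ^ max 1 q * (Q' ^ (q + 1) +
        ((4 * Q') ^ (q + 1) * (8 * (κ ^ 2 * u) * Q') +
          (q + 1 : ℕ) * Real.exp 1 * (2 * ((Real.exp 2 * (κ + ρ)) ^ 2 * u) * (ρ⁻¹ ^ 2 / u) * Q') ^ (q + 1) *
            max 1 (2 * (Real.exp 1 * α / κ ^ 2 * (ε * Kc)) * A' * ((Real.exp 2 * (κ + ρ)) ^ 2 * u) * Q') ^ q +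
          2 * Real.exp 1 * (2 * ((Real.exp 2 * (κ + ρ)) ^ 2 * u) * (ρ⁻¹ ^ 2 / u) * Q') ^ (q + 1) *
            max 1 (2 * (Real.exp 1 * α / κ ^ 2 * (ε * Kc)) * A' * ((Real.exp 2 * (κ + ρ)) ^ 2 * u) * Q') ^ (q + 1)))) := by
  -- abbreviations for the dimensionless constants
  set σh : ℝ := κ ^ 2 * u with hσh
  set τh : ℝ := (Real.exp 2 * (κ + ρ)) ^ 2 * u with hτh
  set Φh : ℝ := Real.exp 1 * α / κ ^ 2 * (ε * Kc) with hΦh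
  set ψh : ℝ := ρ⁻¹ ^ 2 / u with hψh
  have hσ0 : 0 ≤ σh := by positivity
  have hτ0 : 0 ≤ τh := by positivity
  have hΦ0 : 0 ≤ Φh := by positivity
  have hψ0 : 0 ≤ ψh := by positivity
  have hts : 0 ≤ t⁻¹ ^ s := pow_nonneg (inv_nonneg.2 ht.le) _
  have hpre : 0 ≤ t⁻¹ ^ s * (cr' * cc' ^ (2 * q + 1) * (u ^ (q + 1) * (ε * Kc))) := by positivity
  set Pre : ℝ := t⁻¹ ^ s * (cr' * cc' ^ (2 * q + 1) * (u ^ (q + 1) * (ε * Kc))) with hPre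
  -- the reduced left side `b := b₀/Pre − μ(q+1)` obeys T2ε's `hstep` (when `Pre > 0`; the case `Pre = 0` is trivial)
  rcases hpre.eq_or_lt with hPre0 | hPre0
  · -- `Pre = 0` forces `t⁻¹^s · cr′·cc′^{2q+1} = 0`; the door bound at `N₀ = 2` then reads `b₀ ≤ 0 = Pre · (…)`
    have h2 := hb 2 le_rfl
    have hfac : t⁻¹ ^ s * (cr' * cc' ^ (2 * q + 1)) = 0 := by
      have hne : u ^ (q + 1) * (ε * Kc) ≠ 0 := by positivity
      have hprod : t⁻¹ ^ s * (cr' * cc' ^ (2 * q + 1)) * (u ^ (q + 1) * (ε * Kc)) = 0 := by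
        rw [show t⁻¹ ^ s * (cr' * cc' ^ (2 * q + 1)) * (u ^ (q + 1) * (ε * Kc)) = Pre by rw [hPre]; ring]
        exact hPre0.symm
      exact (mul_eq_zero.1 hprod).resolve_right hne
    have hb0 : b₀ ≤ 0 := by
      refine h2.trans (le_of_eq ?_)
      rw [← mul_assoc, hfac, zero_mul]
    rw [← hPre0, zero_mul]
    exact hb0
  -- `Pre > 0`
  set b : ℝ := b₀ / Pre - μ (q + 1) with hbdef
  have hstep : ∀ N : ℕ, 2 ≤ N → Φh * towerV D τh μ < 1 →
      b ≤ towerFO D σh μ (q + 1) + ∑ n ∈ Icc 2 N, Real.exp 1 * Φh ^ (n - 1) * ψh ^ (q + 1) * towerS D τh μ n (q + 1) +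
        ψh ^ (q + 1) * Real.exp 1 * towerV D τh μ * (Φh * towerV D τh μ) ^ N / (1 - Φh * towerV D τh μ) := by
    intro N hN hg
    have h := srcStep_le_kit_units (Γ := Γ) hκ hρ hα hcr hcc ht hε hu hKc hμ0 hμ00 hD s q hb
      (by simpa only [hΦh, hτh, mul_assoc] using hg) (N₀ := N + 1) (by omega)
    rw [Nat.add_sub_cancel] at h
    rw [hbdef, sub_le_iff_le_add, div_le_iff₀ hPre0]
    refine h.trans (le_of_eq ?_)
    rw [hPre, hσh, hτh, hΦh, hψh]
    ring
  have hT2 := towerStep_le_profile_eps (D := D) (μ := μ) (b := b) hσ0 hΦ0 hψ0 hτ0 hA' hlam hlam1 hQ' hμ0 hprof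
    (by simpa only [hσh] using hx₁) (by simpa only [hτh] using hx₃) (by simpa only [hτh] using hxs)
    (by simpa only [hΦh, hτh] using hz) (by simpa only [hΦh, hτh] using hV) (p := q + 1) (by omega) hstep
  -- unfold `b`; the zeroth order `μ(q+1) ≤ A′ λ^{max 1 q} Q′^{q+1}` by the profile
  rw [Nat.add_sub_cancel] at hT2
  have hμq : μ (q + 1) ≤ A' * lam ^ max 1 q * Q' ^ (q + 1) := by
    have h := hprof (q + 1) (by omega) hqD
    rwa [Nat.add_sub_cancel] at h
  have hb₀ : b₀ = Pre * (μ (q + 1) + b) := by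
    rw [hbdef, add_sub_cancel, mul_div_cancel₀ _ hPre0.ne']
  rw [hb₀]
  refine mul_le_mul_of_nonneg_left ((add_le_add hμq hT2).trans (le_of_eq ?_)) hpre
  rw [hσh, hτh, hΦh, hψh]
  ring

end Summit.HubbardSuperconductivity.HubbardSuperconductivity.Theorems.TwoVolumeDefect

end
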